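import Summits.CriticalPhenomena.CardyFormulaZ2.Theses.CardySelfDualSegment
import Summits.CriticalPhenomena.CardyFormulaZ2.Theorems.SegmentOpen.Negative.NormOne
import Summits.CriticalPhenomena.CardyFormulaZ2.Theorems.SegmentOpen.Negative.FrozenModulus
import Summits.CriticalPhenomena.CardyFormulaZ2.Theorems.SegmentOpen.Negative.MarginalNotAnalytic
import Literature.Probability.Percolation.CornerPercolation
import Literature.Barriers.CriticalPhenomena.EmbeddingModulusUniquenessProofs
import Literature.Probability.RandomPlanarGeometry.ConformalRectangleProofs
import Literature.Probability.RandomPlanarGeometry.CardyFunctionIncBeta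
import Literature.Probability.RandomPlanarGeometry.ChordalCurveFamily
import Literature.Probability.LatticeModels.TriangularLatticeProofs
import Literature.Probability.Percolation.LatticeSymmetry
import Literature.Probability.RandomPlanarGeometry.ImageUnivalent
import Literature.Probability.LatticeModels.IsoradialGraphsProofs

/-!
# Disproof of `SegmentOpen` (stmt-CriticalPhenomena-5471) — findings

Crux (route `CardySelfDualSegment`, sub-problem `CardyFormulaZ2`):
`SegmentOpen := UniformMarginality → IsOpen G`, `G = {t ∈ [0,1] | ∃ α, 0 < im α ∧ CardyMod t α}`,
where `CardyMod t α` says that the crude crossing probabilities `P_t(R', δ)` of the corner model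
`M_t` converge, in every conformal rectangle `R'`, to Cardy's value of the sheared rectangle
`φ_α R'` (`φ_α = moduliShear α`).  Cycle 1 of the crux disprover (refuter, cdisprove).

## Findings (cycle 1)

* **No kill.**  An unconditional `¬ SegmentOpen` needs BOTH `UniformMarginality` (crux 5472, XL)
  AND a parameter `t` at which linear universality fails — i.e. a disproof of the
  Langlands–Pouliot–Saint-Aubin universality conjecture for an FKG self-dual model.  Nothing of
  the kind is within reach; conversely the crux is TRIVIALLY TRUE in the two extreme scenarios
  `G = univ` (the Target) and `G = ∅` / `¬ UM` (route dead), `segmentOpen_of_goodSet_eq_univ`,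
  `segmentOpen_of_goodSet_eq_empty`, `segmentOpen_of_not_UM` below: the crux is refutable only in
  the intermediate regime "some but not all `M_t` are linearly universal, and `G` is not open".
* **(a) load-bearing analysis.**  The single hypothesis `UM` cannot be shown load-bearing by a
  `_false_without_UM` theorem (that theorem would be `¬ IsOpen G`, see above).  What CAN be
  proved is that `UM` is far from sufficient: `not_isOpen_goodSet_of_marginal_family` exhibits a
  family `P` of "crossing functions" with the UM property (even affine, hence entire, in `t` —
  the line's `stub_uniformComplexBound` shape), with the Smirnov point `0 ∈ G_P` at modulus
  `ζ = e^{iπ/3}`, and `G_P = {0}` (`goodSetOf_toy`), so `G_P` is not open.  Hence ANY proof of the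
  crux must use properties of `cornerCrossingProb` beyond equicontinuity/analyticity in `t` and
  the base point — in the lead's line `Sketch` this is exactly `stub_noIsolatedGoodPoint` (S6);
  stubs S1, S2, S4, S5 hold (S5 vacuously) for the toy family.
* **(b) rigidity / tightness of the conclusion.**  `modulus_unique`: for ANY family `P` and any
  `t`, at most one modulus `α` of the upper half-plane satisfies `CardyMod`; so `G` carries a
  well-defined modulus function `t ↦ α(t)` and openness cannot be obtained by switching to a
  second modulus — `α` has to MOVE (continuously, by `SegmentClosed`-type arguments).  Proof:
  Beffara's rigidity `BeffaraShearDistortsModulus_holds` + injectivity of Cardy's `F`.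
* **(b') `‖α‖ = 1` (§4, `norm_eq_one_of_cardyMod`).**  For EVERY good point `t` and every
  witness `α` (`0 < im α`, `CardyMod t α`): `‖α‖ = 1`.  Proof: the diagonal-reflection
  invariance of `M_t` at every mesh (`cornerCrossingProb_map_transpose`) turns `CardyMod α` into
  `CardyMod α⁻¹`; conjugation (any family) into `CardyMod (α/‖α‖²)`; modulus uniqueness closes.
  So the `∃ α` of the crux ranges over the arc `e^{iθ}`, `θ ∈ (0,π)`; the chart of S5 is 1-dimensional.
* **(c) numerics (kit jobs, see `-- Numerics` at the end):** Russo-sum Monte Carlo of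
  `∂_t P_t` for the diamond (exact modulus chart) and boxes, `L = 8 … 256`, `t ∈ {0,¼,½,¾,1}`
  (first-order UniformMarginality, the crux's hypothesis, measured directly by pivotal counting
  with an exactly-zero sentinel shape); exact transfer-matrix crossing polynomials at complex `t`
  up to 12 rows with Newton/argument-principle tracking of the complex zeros nearest to `[0,1]`
  (the cheapest falsifier of the line's `stub_uniformComplexBound`).  Results are appended here
  and attached to the crux item when the jobs return.

## Findings (cycle 2 — refuter-cdisprove-stmt-CriticalPhenomena-5471-g2-0, 2026-08-16)

* **Still no kill** (same case analysis as cycle 1: an unconditional `¬ SegmentOpen` needs `UM`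
  AND a non-open `G`).  Two batches of NEGATIVE LEMMAS landed instead, and the line's research stub
  S4 (`stub_uniformComplexBound`, UA) is put under an exact transfer-matrix probe.
* **(d) the modulus is pinned at both ends; frozen-modulus strengthenings are FALSE** (§6; landed
  `Theorems/SegmentOpen/Negative/FrozenModulus.lean`, p117497).  From the proved cone items
  `smirnovBasePoint_proof` (5474) and `quarterTurnPinning_proof` (5475) plus modulus uniqueness:
  `α(0) = ζ`, `α(1) = i` (`modulus_zero_eq_triZeta`, `modulus_one_eq_I`); hence
  `not_exists_frozen_modulus : ¬ ∃ α, 0 < im α ∧ ∀ t, CardyMod t α` — the Target's `∀t ∃α` cannot be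
  swapped to `∃α ∀t` (LPS linear universality with ONE linear map fails along the segment); and
  `not_forall_isOpen_goodSetAt_of_target : Target → ¬ ∀ α, 0 < im α → IsOpen G_α` with
  `G_α = {t | CardyMod t α}` — the `G_α` partition `G`, `G_ζ ∋ 0`, `G_i ∋ 1`, so they cannot all be
  open in the connected `[0,1]`: **openness cannot be proved modulus-by-modulus; every proof of the
  crux must move the shear** (in line `Sketch`: the chart of S5 must deliver `α(t) → ζ` at `0` and
  `→ i` at `1`; the numerics' `θ_t : 60° → 90°` is consistent).  Also `cardyMod'_of_im_eq_zero`: for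
  REAL `α` the template holds vacuously (`φ_α` collapses `ℂ` to `ℝ`), so the side condition
  `0 < im α` is what keeps `G` (and the Target) non-trivial; `im α < 0` is the conjugate case.
* **(e) marginality does not give uniform analyticity** (§5; landed
  `Theorems/SegmentOpen/Negative/MarginalNotAnalytic.lean`, p117785):
  the line's S4 (UA: crossing polynomials bounded on one complex disc around each `t₀`, uniformly in
  `δ`) is NOT a consequence of the crux hypothesis UM, even for `[0,1]`-valued polynomial families
  uniformly Lipschitz on `[0,1]`: `p_n = (4X(1-X))^{n+1}/(n+1)` is `4`-Lipschitz with values in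
  `[0,1]` and `|p_n(1/2+iy)| = (1+4y²)^{n+1}/(n+1) → ∞` (`not_uniformComplexBound_of_marginal_abstract`).
  Sharper (`Theorems/SegmentOpen/Negative/AllOrdersNotAnalytic.lean`, proposal p118266): even
  ALL-ORDERS marginality — every Taylor coefficient at `t₀` bounded uniformly in the mesh — does not
  give UA: `p_n = e^{-2√n}(4X(1-X))^n` has jets at `1/2` bounded by `(2k)!` (→ 0) and still blows up
  (`not_uniformComplexBound_of_allOrders_marginal_abstract`); "S4 = all-orders marginality" holds
  in one direction only, S4 is non-perturbative (Lee–Yang type).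
  So S4 is an unconditional, model-specific claim and UM is logically idle in line `Sketch`
  (UA ⊢ UM).  What UA MEANS for the corner model (§5 docstrings): with splitting bits `d_v` at bias
  `t₀/2`, `P_t = Σ_k ((t-t₀)/2σ)^k W_k`, `W_k = Σ_{|S|=k} ĝ_{t₀}(S)` the SIGNED level-`k` Fourier sums
  of the coin-averaged crossing function; UA at `t₀` with radius `r` ⇔ `|W_k(δ)| ≤ C (2σ/r)^k`
  uniformly in `δ` — bounded signed level sums at every fixed level (level 1 = first-order
  marginality = the Russo sum), although the unsigned level-`k` mass is `~ δ^{-3k/4}`.  At `t₀ = 0`,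
  radius `r > s` forces `|P_{-s}| = (1+s)^{N_δ} · |E_{s/(2+2s)}[(-1)^{#split corners} 1_cross]| ≤ C`:
  an EXPONENTIALLY small parity/crossing correlation (`e^{-c s δ^{-2}}`), exactly `0` for the
  self-dual box by the `π`-rotation-duality pairing, unknown in general — this is the quantity the
  transfer-matrix probe measures on the negative real axis.
* **(f) numerics, cycle 2** (`-- Numerics`): the cycle-1 jobs were lost to this seat (owner-locked
  artefacts), so S4 was re-probed by ONE family of exact complex-`t` transfer-matrix computations
  with a validated code (brute-force agreement on small boxes, self-dual sentinel `P ≡ 1/2`,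
  double vs 80-bit agreement `≤ 3·10⁻¹²`): `H = 3…13` done (local + kit j019207, j019209, j019453, j019469; 2:1 at `H = 13`: j019650 queued).  OUTCOME: a size-stable TAME PLATEAU on
  `|t - c| ≤ 1.25` (`c = 0, ½, 1`) surrounded by an EXPONENTIAL BLOW-UP REGION whose rate per
  corner `ψ(t) = Δlog|P|/ΔN` is size-stable and vanishes LINEARLY on a boundary at FINITE distance
  (`t ≈ -1.1`, `≈ ±1.7–1.95 i` above `[0,1]`, `≈ 2.3`); the drifting apparent thresholds are the
  visibility effect `ψ·N ≈ const`; a prediction made at `H ≤ 9` (2:1 plateau breaks at `2i` near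
  `H ≈ 10–11`, not at `1 + 2i`) was confirmed at `H = 10, 11`.  So `stub_uniformComplexBound` is
  numerically SUPPORTED with radius `≈ 1` — no kill; undecidable here: logarithmic growth of a
  fixed-order Taylor coefficient (which would still falsify UA).

All prose is in docstrings; everything below elaborates (`lean check` rc 0); `sorry` only in the
explicitly marked near-miss section (none at present).
-/

noncomputable section

namespace Summit.CriticalPhenomena.CardyFormulaZ2.Cruxes.SegmentOpen.Disproof

open Set Filter Topology Complex
open scoped ComplexConjugate
open UpperHalfPlane (upperHalfPlaneSet)
open Literature.Probability.RandomPlanarGeometry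
open Literature.Barriers.CriticalPhenomena
open Literature.Probability.LatticeModels (triZeta triZeta_im Site squareLatticeEmbedding squareLatticeEmbedding_z)
open Literature.Probability.Percolation (cornerCrossingProb cornerCrossingProb_eq cornerPercolation
  embDomainCrossing openCrossing transposeIso image_transposeIso preimage_relabel_openCrossing
  cornerPercolation_real_preimage_relabel_transpose)
open Summit.CriticalPhenomena.CardyFormulaZ2.Theses.CardySelfDualSegment (SegmentOpen Target)

/-! ## §0 The crux over the library API (definitional bridge) -/

/-- Cardy-after-the-shear-`φ_α` for an ABSTRACT family `P : ConformalRectangle → ℝ → ℝ` of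
crossing functions (`P R' δ` = crossing probability of `R'` at mesh `δ`): the route's `CardyMod t α`
is `CardyModOf (cornerCrossingProb t) α`. -/
def CardyModOf (P : ConformalRectangle → ℝ → ℝ) (α : ℂ) : Prop :=
  ∀ (R R' : ConformalRectangle) (φ : ConformalEquiv upperHalfPlaneSet R.carrier) (x : Fin 4 → ℝ),
    R.carrier = moduliShear α '' R'.carrier → (∀ i, R.pt i = moduliShear α (R'.pt i)) →
    R.IsUniformizing φ x → Tendsto (P R') (𝓝[>] 0) (𝓝 (cardyFunction (crossRatio x)))

/-- The good set `G_P = {t | ∃ α ∈ ℍ, CardyModOf (P t) α}` of an abstract one-parameter family. -/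
def goodSetOf (P : unitInterval → ConformalRectangle → ℝ → ℝ) : Set unitInterval :=
  {t | ∃ α : ℂ, 0 < α.im ∧ CardyModOf (P t) α}

/-- The UniformMarginality SHAPE for an abstract family: equicontinuity in `t`, pointwise in `R`,
uniform in the mesh. The route's `UniformMarginality` is `UMOf cornerCrossingProb`. -/
def UMOf (P : unitInterval → ConformalRectangle → ℝ → ℝ) : Prop :=
  ∀ (t₀ : unitInterval) (R : ConformalRectangle) (ε : ℝ), 0 < ε → ∃ η > 0, ∀ t : unitInterval,
    dist t t₀ < η → ∀ δ : ℝ, 0 < δ → |P t R δ - P t₀ R δ| < ε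

/-- **Bridge** (by `Iff.rfl`): the route decl `SegmentOpen` is literally
`UMOf cornerCrossingProb → IsOpen (goodSetOf cornerCrossingProb)` — the inlined `let`-blocks of the
route are `cornerParam`/`cornerConfig`/`cornerCrossingProb` verbatim. -/
theorem segmentOpen_iff :
    SegmentOpen ↔ (UMOf Literature.Probability.Percolation.cornerCrossingProb →
      IsOpen (goodSetOf Literature.Probability.Percolation.cornerCrossingProb)) :=
  Iff.rfl

/-! ## §1 The three trivialising scenarios (why an unconditional kill is out of reach)

`SegmentOpen` is an implication with an XL hypothesis and a conclusion about the unknown set `G`.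
It is (trivially) TRUE if `UM` fails, if `G = [0,1]` (the Target), or if `G = ∅`.  A refutation
must therefore establish `UM`, produce a point of `G` (only `t = 0` is available: Smirnov) AND a
non-interior point of `G` — the last is a failure of linear universality at parameters
accumulating at a universal one.  These one-liners record the case analysis. -/

/-- If UniformMarginality fails, the crux holds vacuously (and the route dies: kill criterion). -/
theorem segmentOpen_of_not_UM
    (h : ¬ UMOf Literature.Probability.Percolation.cornerCrossingProb) : SegmentOpen :=
  segmentOpen_iff.2 fun hUM => (h hUM).elim

/-- If every `M_t` is linearly universal (the route's Target), the crux holds trivially. -/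
theorem segmentOpen_of_goodSet_eq_univ
    (h : goodSetOf Literature.Probability.Percolation.cornerCrossingProb = univ) : SegmentOpen :=
  segmentOpen_iff.2 fun _ => by rw [h]; exact isOpen_univ

/-- If NO `M_t` is linearly universal (not even Smirnov's `t = 0`, i.e. the crude-event
bookkeeping `SmirnovBasePoint` fails), the crux holds trivially. -/
theorem segmentOpen_of_goodSet_eq_empty
    (h : goodSetOf Literature.Probability.Percolation.cornerCrossingProb = ∅) : SegmentOpen :=
  segmentOpen_iff.2 fun _ => by rw [h]; exact isOpen_empty

/-! ## §2 Rigidity of the conclusion: the modulus in `G` is unique (tightness lemma)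

For ANY family of crossing functions the modulus `α ∈ ℍ` with Cardy limits after `φ_α` is unique.
Consequently `t ∈ G` determines `α(t)`, and "openness" is the statement that this FUNCTION extends
to a neighbourhood; no proof can exploit a freedom in `α`.  (Beffara 2008, Prop. 4, proved in the
tree as `BeffaraShearDistortsModulus_holds`; plus injectivity of Cardy's function.) -/

/-- Uniqueness of `δ → 0⁺` limits of a real function. -/
theorem limit_unique {f : ℝ → ℝ} {a b : ℝ} (ha : Tendsto f (𝓝[>] 0) (𝓝 a))
    (hb : Tendsto f (𝓝[>] 0) (𝓝 b)) : a = b :=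
  tendsto_nhds_unique ha hb

/-- Cardy's function is injective on the cross-ratios of uniformizing data. -/
theorem cardy_crossRatio_injective {R R' : ConformalRectangle}
    {φ : ConformalEquiv upperHalfPlaneSet R.carrier} {x : Fin 4 → ℝ}
    {φ' : ConformalEquiv upperHalfPlaneSet R'.carrier} {x' : Fin 4 → ℝ}
    (h : R.IsUniformizing φ x) (h' : R'.IsUniformizing φ' x')
    (he : cardyFunction (crossRatio x) = cardyFunction (crossRatio x')) :
    crossRatio x = crossRatio x' := by
  have hx := ConformalRectangle.crossRatio_mem_Ioo_of_isUniformizing h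
  have hx' := ConformalRectangle.crossRatio_mem_Ioo_of_isUniformizing h'
  exact strictMonoOn_cardyFunction_holds.injOn ⟨hx.1.le, hx.2.le⟩ ⟨hx'.1.le, hx'.2.le⟩ he

/-- Pulling a conformal rectangle back through the shear `φ_α`: `R = φ_α (R.map φ_α⁻¹)`. -/
theorem carrier_eq_image_map_symm (R : ConformalRectangle) {α : ℂ} (hα : α.im ≠ 0) :
    R.carrier = moduliShear α '' (R.map (shearHomeomorph α hα).symm).carrier := by
  rw [MarkedDomain.carrier_map, image_image]
  have : (fun z => moduliShear α ((shearHomeomorph α hα).symm z)) = id :=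
    funext fun z => (shearHomeomorph α hα).apply_symm_apply z
  rw [this, image_id]

/-- Marked points of the pull-back. -/
theorem pt_eq_moduliShear_map_symm (R : ConformalRectangle) {α : ℂ} (hα : α.im ≠ 0) (i : Fin 4) :
    R.pt i = moduliShear α ((R.map (shearHomeomorph α hα).symm).pt i) := by
  rw [MarkedDomain.pt_map]
  exact ((shearHomeomorph α hα).apply_symm_apply (R.pt i)).symm

/-- Composition of shears on carriers: `φ_γ '' (φ_α '' S) = φ_{φ_γ α} '' S`. -/
theorem image_moduliShear_moduliShear (γ α : ℂ) (S : Set ℂ) :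
    moduliShear γ '' (moduliShear α '' S) = moduliShear (moduliShear γ α) '' S := by
  rw [image_image]
  exact image_congr fun z _ => moduliShear_moduliShear γ α z

/-- **Modulus uniqueness (rigidity of the crux's conclusion).**  For any family `P` of crossing
functions, two moduli of the upper half-plane with Cardy limits after the corresponding shears
coincide.  Proof: with `φ_γ ∘ φ_α = φ_β`, `γ ∈ ℍ ∖ {i}` if `α ≠ β`; Beffara's two rectangles
`R₁, R₂` of equal modulus with `φ_γ`-images of different moduli, pulled back through `φ_α`, have
`P`-limits equal to `F(η(R_j))` (modulus `α`) and to `F(η(φ_γ R_j))` (modulus `β`); limits are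
unique and `F` is injective — contradiction. -/
theorem modulus_unique {P : ConformalRectangle → ℝ → ℝ} {α β : ℂ} (hα : 0 < α.im) (hβ : 0 < β.im)
    (hA : CardyModOf P α) (hB : CardyModOf P β) : α = β := by
  by_contra hne
  set γ : ℂ := (β - (α.re : ℂ)) / (α.im : ℂ) with hγ
  have hγα : moduliShear γ α = β := moduliShear_connect hα.ne' β
  have hγim : 0 < γ.im := by rw [hγ, moduliShear_connect_im]; exact div_pos hβ hα
  have hγI : γ ≠ I := by
    intro h; apply hne; rw [← hγα, h, moduliShear_I_apply]
  obtain ⟨R₁, R₂, R₁', R₂', φ₁, x₁, φ₂, x₂, φ₁', x₁', φ₂', x₂', h₁, h₂, h₁', h₂', ⟨hc₁, hp₁⟩,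
    ⟨hc₂, hp₂⟩, hcr, hcr'⟩ := BeffaraShearDistortsModulus_holds γ hγim hγI
  -- pull-backs `Q_j = φ_α⁻¹ R_j`
  set Q₁ := R₁.map (shearHomeomorph α hα.ne').symm with hQ₁
  set Q₂ := R₂.map (shearHomeomorph α hα.ne').symm with hQ₂
  have hcQ₁ : R₁.carrier = moduliShear α '' Q₁.carrier := carrier_eq_image_map_symm R₁ hα.ne'
  have hcQ₂ : R₂.carrier = moduliShear α '' Q₂.carrier := carrier_eq_image_map_symm R₂ hα.ne'
  have hpQ₁ : ∀ i, R₁.pt i = moduliShear α (Q₁.pt i) := pt_eq_moduliShear_map_symm R₁ hα.ne'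
  have hpQ₂ : ∀ i, R₂.pt i = moduliShear α (Q₂.pt i) := pt_eq_moduliShear_map_symm R₂ hα.ne'
  -- limits at modulus `α`
  have tA₁ := hA R₁ Q₁ φ₁ x₁ hcQ₁ hpQ₁ h₁
  have tA₂ := hA R₂ Q₂ φ₂ x₂ hcQ₂ hpQ₂ h₂
  -- limits at modulus `β = φ_γ α`
  have hcQ₁' : R₁'.carrier = moduliShear β '' Q₁.carrier := by
    rw [hc₁, hcQ₁, image_moduliShear_moduliShear, hγα]
  have hcQ₂' : R₂'.carrier = moduliShear β '' Q₂.carrier := by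
    rw [hc₂, hcQ₂, image_moduliShear_moduliShear, hγα]
  have hpQ₁' : ∀ i, R₁'.pt i = moduliShear β (Q₁.pt i) := fun i => by
    rw [hp₁ i, hpQ₁ i, moduliShear_moduliShear, hγα]
  have hpQ₂' : ∀ i, R₂'.pt i = moduliShear β (Q₂.pt i) := fun i => by
    rw [hp₂ i, hpQ₂ i, moduliShear_moduliShear, hγα]
  have tB₁ := hB R₁' Q₁ φ₁' x₁' hcQ₁' hpQ₁' h₁'
  have tB₂ := hB R₂' Q₂ φ₂' x₂' hcQ₂' hpQ₂' h₂'
  have e₁ : cardyFunction (crossRatio x₁) = cardyFunction (crossRatio x₁') := limit_unique tA₁ tB₁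
  have e₂ : cardyFunction (crossRatio x₂) = cardyFunction (crossRatio x₂') := limit_unique tA₂ tB₂
  have e : cardyFunction (crossRatio x₁') = cardyFunction (crossRatio x₂') := by
    rw [← e₁, ← e₂, hcr]
  exact hcr' (cardy_crossRatio_injective h₁' h₂' e)

/-- The crux's own good set has a well-defined modulus function (corollary for
`P = cornerCrossingProb t`). -/
theorem goodSet_modulus_unique {t : unitInterval} {α β : ℂ} (hα : 0 < α.im) (hβ : 0 < β.im)
    (hA : CardyModOf (Literature.Probability.Percolation.cornerCrossingProb t) α)
    (hB : CardyModOf (Literature.Probability.Percolation.cornerCrossingProb t) β) : α = β :=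
  modulus_unique hα hβ hA hB

/-! ## §3 Openness is not formal: a marginal, analytic family with `G = {0}`

The NATURAL STRENGTHENING "every family `P` with the UM property and a Cardy base point has an
open good set" is FALSE.  Toy family: `P t R' δ := (1 - t) · F(η(φ_ζ R'))`, `ζ = e^{iπ/3}`:
affine in `t` (so uniformly analytic: the line's S4 shape), UM with `η = ε`, Smirnov point
`0 ∈ G_P` at modulus `ζ`, and `t ∉ G_P` for every `t ≠ 0` (for `α = ζ` the value `(1-t)F(η)`
is not `F(η)`; for `α ≠ ζ` Beffara's rigidity forbids Cardy limits at all, as in §2).  So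
`G_P = {0}` is not open: marginality + analyticity + base point do not give openness; a proof of
the crux must use the percolation structure of `M_t` (locality / duality / RSW / noise), which in
line `Sketch` is concentrated in `stub_noIsolatedGoodPoint`. -/

/-- `im ζ ≠ 0` for Smirnov's modulus `ζ = e^{iπ/3}`. -/
theorem triZeta_im_ne : triZeta.im ≠ 0 := by
  rw [triZeta_im]; positivity

/-- `0 < im ζ`. -/
theorem triZeta_im_pos' : 0 < triZeta.im := by
  rw [triZeta_im]; positivity

/-- A chosen uniformizing datum of a conformal rectangle (Riemann + Carathéodory, in tree). -/
theorem exists_datum (D : ConformalRectangle) :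
    ∃ φ : ConformalEquiv upperHalfPlaneSet D.carrier, ∃ x : Fin 4 → ℝ, D.IsUniformizing φ x :=
  MarkedDomain.exists_isUniformizing_holds D

/-- The boundary preimages of a chosen uniformizing datum of `D`. -/
def datum (D : ConformalRectangle) : Fin 4 → ℝ :=
  Classical.choose (Classical.choose_spec (exists_datum D))

/-- The chosen datum uniformizes. -/
theorem isUniformizing_datum (D : ConformalRectangle) :
    D.IsUniformizing (Classical.choose (exists_datum D)) (datum D) :=
  Classical.choose_spec (Classical.choose_spec (exists_datum D))

/-- **Transport of the modulus across two presentations of the same marked domain**: marked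
domains with the same carrier and the same marked points have uniformizing data of equal
cross-ratio (`IsUniformizing` only sees `carrier` and `pt`; then
`crossRatio_eq_of_isUniformizing_holds`). -/
theorem crossRatio_eq_of_carrier_eq {R D : ConformalRectangle} (hc : R.carrier = D.carrier)
    (hp : ∀ i, R.pt i = D.pt i)
    {φ : ConformalEquiv upperHalfPlaneSet R.carrier} {x : Fin 4 → ℝ} (h : R.IsUniformizing φ x)
    {ψ : ConformalEquiv upperHalfPlaneSet D.carrier} {y : Fin 4 → ℝ} (h' : D.IsUniformizing ψ y) :
    crossRatio x = crossRatio y := by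
  have key : ∀ (S : Set ℂ) (hS : S = D.carrier) (φ' : ConformalEquiv upperHalfPlaneSet S),
      ((StrictMono x ∨ StrictAnti x) ∧ ∀ i, φ'.HasBoundaryValue (x i) (R.pt i)) →
        crossRatio x = crossRatio y := by
    intro S hS φ' hφ'
    subst hS
    have hu : D.IsUniformizing φ' x := ⟨hφ'.1, fun i => by rw [← hp i]; exact hφ'.2 i⟩
    exact ConformalRectangle.crossRatio_eq_of_isUniformizing_holds hu h'
  exact key R.carrier hc φ h

/-- Cardy's value of the sheared rectangle `φ_α R'` (via a chosen datum of `R'.map φ_α`). -/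
def cardyShearValue (α : ℂ) (hα : α.im ≠ 0) (R' : ConformalRectangle) : ℝ :=
  cardyFunction (crossRatio (datum (R'.map (shearHomeomorph α hα))))

/-- `cardyShearValue ∈ (0, 1)`. -/
theorem cardyShearValue_mem_Ioo (α : ℂ) (hα : α.im ≠ 0) (R' : ConformalRectangle) :
    cardyShearValue α hα R' ∈ Ioo (0 : ℝ) 1 := by
  unfold cardyShearValue
  have hx := ConformalRectangle.crossRatio_mem_Ioo_of_isUniformizing
    (isUniformizing_datum (R'.map (shearHomeomorph α hα)))
  have hmono : StrictMonoOn cardyFunction (Icc 0 1) := strictMonoOn_cardyFunction_holds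
  have hx' : crossRatio (datum (R'.map (shearHomeomorph α hα))) ∈ Icc (0 : ℝ) 1 :=
    ⟨hx.1.le, hx.2.le⟩
  constructor
  · have h := hmono (left_mem_Icc.2 zero_le_one) hx' hx.1
    rwa [cardyFunction_zero] at h
  · have h := hmono hx' (right_mem_Icc.2 zero_le_one) hx.2
    rwa [cardyFunction_one_holds] at h

/-- `cardyShearValue α` IS a Cardy functional of modulus `α`: it has "Cardy limits after `φ_α`"
as a constant family (the transport lemma identifies the chosen datum's cross-ratio with that of
any presentation `R` of `φ_α R'`). -/
theorem cardyModOf_const_cardyShearValue (α : ℂ) (hα : α.im ≠ 0) :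
    CardyModOf (fun R' _ => cardyShearValue α hα R') α := by
  intro R R' φ x hc hp hu
  have hc' : R.carrier = (R'.map (shearHomeomorph α hα)).carrier := by
    rw [hc, MarkedDomain.carrier_map, coe_shearHomeomorph]
  have hp' : ∀ i, R.pt i = (R'.map (shearHomeomorph α hα)).pt i := fun i => by
    rw [hp i, MarkedDomain.pt_map, coe_shearHomeomorph]
  have e : crossRatio x = crossRatio (datum (R'.map (shearHomeomorph α hα))) :=
    crossRatio_eq_of_carrier_eq hc' hp' hu (isUniformizing_datum _)
  show Tendsto (fun _ : ℝ => cardyShearValue α hα R') (𝓝[>] 0) (𝓝 (cardyFunction (crossRatio x)))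
  unfold cardyShearValue
  rw [← e]
  exact tendsto_const_nhds

/-- **The toy family**: `P t R' δ := (1 - t) · F(η(φ_ζ R'))`. -/
def toyP (t : unitInterval) (R' : ConformalRectangle) (_δ : ℝ) : ℝ :=
  (1 - (t : ℝ)) * cardyShearValue triZeta triZeta_im_ne R'

/-- The toy family is affine in `t` (hence a polynomial of degree `≤ 1`, entire, uniformly bounded
on every complex disc: the shapes of `stub_crossingProbPolynomial` / `stub_uniformComplexBound`). -/
theorem toyP_affine (R' : ConformalRectangle) (δ : ℝ) :
    ∃ a b : ℝ, ∀ t : unitInterval, toyP t R' δ = a + b * (t : ℝ) :=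
  ⟨cardyShearValue triZeta triZeta_im_ne R', -cardyShearValue triZeta triZeta_im_ne R',
    fun t => by unfold toyP; ring⟩

/-- The toy family has the UniformMarginality property (with `η = ε`: it is `1`-Lipschitz in `t`
uniformly in `R'` and `δ`). -/
theorem umOf_toyP : UMOf toyP := by
  intro t₀ R ε hε
  refine ⟨ε, hε, fun t ht δ _ => ?_⟩
  have hc := cardyShearValue_mem_Ioo triZeta triZeta_im_ne R
  have h1 : toyP t R δ - toyP t₀ R δ =
      ((t₀ : ℝ) - (t : ℝ)) * cardyShearValue triZeta triZeta_im_ne R := by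
    unfold toyP; ring
  rw [h1, abs_mul, abs_of_pos hc.1]
  have hd : |(t₀ : ℝ) - (t : ℝ)| = dist t t₀ := by
    rw [Subtype.dist_eq, Real.dist_eq, abs_sub_comm]
  calc |(t₀ : ℝ) - (t : ℝ)| * cardyShearValue triZeta triZeta_im_ne R
      ≤ |(t₀ : ℝ) - (t : ℝ)| * 1 := by gcongr; exact hc.2.le
    _ = dist t t₀ := by rw [mul_one, hd]
    _ < ε := ht

/-- The Smirnov point: `0 ∈ G_toy` with modulus `ζ = e^{iπ/3}`. -/
theorem zero_mem_goodSetOf_toyP : (0 : unitInterval) ∈ goodSetOf toyP := by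
  refine ⟨triZeta, triZeta_im_pos', ?_⟩
  intro R R' φ x hc hp hu
  have h := cardyModOf_const_cardyShearValue triZeta triZeta_im_ne R R' φ x hc hp hu
  have e : toyP 0 R' = fun _ => cardyShearValue triZeta triZeta_im_ne R' := by
    funext δ; simp [toyP]
  rw [e]; exact h

/-- No `t ≠ 0` is a good point of the toy family, for ANY modulus: for `α = ζ` the limit
`(1 - t)F(η)` differs from `F(η) > 0`; for `α ≠ ζ` this is modulus uniqueness (§2) in disguise —
Beffara's two rectangles pulled back through `φ_ζ` get `φ_α`-Cardy values that must be both equal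
and different. -/
theorem not_mem_goodSetOf_toyP {t : unitInterval} (ht : t ≠ 0) : t ∉ goodSetOf toyP := by
  rintro ⟨α, hα, hC⟩
  have ht' : (t : ℝ) ≠ 0 := fun h => ht (Subtype.ext h)
  by_cases hαζ : α = triZeta
  · subst hαζ
    -- take `R' := unit disc rectangle`, `R := φ_ζ R'` with its chosen datum
    obtain ⟨R'⟩ := (inferInstance : Nonempty ConformalRectangle)
    set D := R'.map (shearHomeomorph triZeta triZeta_im_ne) with hD
    have h := hC D R' (Classical.choose (exists_datum D)) (datum D)
      (by rw [hD, MarkedDomain.carrier_map, coe_shearHomeomorph])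
      (fun i => by rw [hD, MarkedDomain.pt_map, coe_shearHomeomorph]) (isUniformizing_datum D)
    -- the toy value is the constant `(1 - t) F(η_D)`, the claimed limit is `F(η_D)`
    have cst : Tendsto (toyP t R') (𝓝[>] 0)
        (𝓝 ((1 - (t : ℝ)) * cardyShearValue triZeta triZeta_im_ne R')) := tendsto_const_nhds
    have hlim : (1 - (t : ℝ)) * cardyShearValue triZeta triZeta_im_ne R' =
        cardyFunction (crossRatio (datum D)) := limit_unique cst h
    have hval : cardyShearValue triZeta triZeta_im_ne R' = cardyFunction (crossRatio (datum D)) :=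
      rfl
    have hpos := (cardyShearValue_mem_Ioo triZeta triZeta_im_ne R').1
    rw [← hval] at hlim
    have : (t : ℝ) * cardyShearValue triZeta triZeta_im_ne R' = 0 := by linarith
    rcases mul_eq_zero.1 this with h0 | h0
    · exact ht' h0
    · exact hpos.ne' h0
  · -- `α ≠ ζ`: Beffara's rigidity at the connecting shear `γ`, `φ_γ ζ = α`
    set γ : ℂ := (α - (triZeta.re : ℂ)) / (triZeta.im : ℂ) with hγ
    have hγζ : moduliShear γ triZeta = α := moduliShear_connect triZeta_im_ne α
    have hγim : 0 < γ.im := by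
      rw [hγ, moduliShear_connect_im]; exact div_pos hα triZeta_im_pos'
    have hγI : γ ≠ I := by
      intro h; apply hαζ; rw [← hγζ, h, moduliShear_I_apply]
    obtain ⟨R₁, R₂, R₁', R₂', φ₁, x₁, φ₂, x₂, φ₁', x₁', φ₂', x₂', h₁, h₂, h₁', h₂', ⟨hc₁, hp₁⟩,
      ⟨hc₂, hp₂⟩, hcr, hcr'⟩ := BeffaraShearDistortsModulus_holds γ hγim hγI
    set Q₁ := R₁.map (shearHomeomorph triZeta triZeta_im_ne).symm with hQ₁
    set Q₂ := R₂.map (shearHomeomorph triZeta triZeta_im_ne).symm with hQ₂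
    have hcQ₁ : R₁.carrier = moduliShear triZeta '' Q₁.carrier :=
      carrier_eq_image_map_symm R₁ triZeta_im_ne
    have hcQ₂ : R₂.carrier = moduliShear triZeta '' Q₂.carrier :=
      carrier_eq_image_map_symm R₂ triZeta_im_ne
    have hpQ₁ : ∀ i, R₁.pt i = moduliShear triZeta (Q₁.pt i) :=
      pt_eq_moduliShear_map_symm R₁ triZeta_im_ne
    have hpQ₂ : ∀ i, R₂.pt i = moduliShear triZeta (Q₂.pt i) :=
      pt_eq_moduliShear_map_symm R₂ triZeta_im_ne
    -- the toy values: `cardyShearValue ζ Q_j = F(η_j)` (transport through the two presentations)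
    have hv : ∀ (Rj Qj : ConformalRectangle) (φj : ConformalEquiv upperHalfPlaneSet Rj.carrier)
        (xj : Fin 4 → ℝ), Rj.carrier = moduliShear triZeta '' Qj.carrier →
        (∀ i, Rj.pt i = moduliShear triZeta (Qj.pt i)) → Rj.IsUniformizing φj xj →
        cardyShearValue triZeta triZeta_im_ne Qj = cardyFunction (crossRatio xj) := by
      intro Rj Qj φj xj hcj hpj huj
      have := cardyModOf_const_cardyShearValue triZeta triZeta_im_ne Rj Qj φj xj hcj hpj huj
      exact limit_unique (tendsto_const_nhds) this
    have v₁ := hv R₁ Q₁ φ₁ x₁ hcQ₁ hpQ₁ h₁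
    have v₂ := hv R₂ Q₂ φ₂ x₂ hcQ₂ hpQ₂ h₂
    -- the claimed `φ_α`-Cardy limits of the toy at `Q_j`, read in `R_j' = φ_γ R_j = φ_α Q_j`
    have hcQ₁' : R₁'.carrier = moduliShear α '' Q₁.carrier := by
      rw [hc₁, hcQ₁, image_moduliShear_moduliShear, hγζ]
    have hcQ₂' : R₂'.carrier = moduliShear α '' Q₂.carrier := by
      rw [hc₂, hcQ₂, image_moduliShear_moduliShear, hγζ]
    have hpQ₁' : ∀ i, R₁'.pt i = moduliShear α (Q₁.pt i) := fun i => by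
      rw [hp₁ i, hpQ₁ i, moduliShear_moduliShear, hγζ]
    have hpQ₂' : ∀ i, R₂'.pt i = moduliShear α (Q₂.pt i) := fun i => by
      rw [hp₂ i, hpQ₂ i, moduliShear_moduliShear, hγζ]
    have tB₁ := hC R₁' Q₁ φ₁' x₁' hcQ₁' hpQ₁' h₁'
    have tB₂ := hC R₂' Q₂ φ₂' x₂' hcQ₂' hpQ₂' h₂'
    have cst : ∀ Q : ConformalRectangle, Tendsto (toyP t Q) (𝓝[>] 0)
        (𝓝 ((1 - (t : ℝ)) * cardyShearValue triZeta triZeta_im_ne Q)) :=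
      fun Q => tendsto_const_nhds
    have e₁ : (1 - (t : ℝ)) * cardyShearValue triZeta triZeta_im_ne Q₁ =
        cardyFunction (crossRatio x₁') := limit_unique (cst Q₁) tB₁
    have e₂ : (1 - (t : ℝ)) * cardyShearValue triZeta triZeta_im_ne Q₂ =
        cardyFunction (crossRatio x₂') := limit_unique (cst Q₂) tB₂
    have e : cardyFunction (crossRatio x₁') = cardyFunction (crossRatio x₂') := by
      rw [← e₁, ← e₂, v₁, v₂, hcr]
    exact hcr' (cardy_crossRatio_injective h₁' h₂' e)

/-- The toy's good set is EXACTLY the Smirnov point. -/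
theorem goodSetOf_toyP : goodSetOf toyP = {0} := by
  ext t
  refine ⟨fun h => ?_, fun h => ?_⟩
  · by_contra hne
    exact not_mem_goodSetOf_toyP hne h
  · rw [mem_singleton_iff] at h
    subst h
    exact zero_mem_goodSetOf_toyP

/-- `{0}` is not open in `[0,1]`. -/
theorem not_isOpen_singleton_zero : ¬ IsOpen ({0} : Set unitInterval) := by
  intro h
  rw [Metric.isOpen_iff] at h
  obtain ⟨ε, hε, hball⟩ := h 0 (mem_singleton _)
  set s : ℝ := min (ε / 2) 1 with hs
  have hs0 : 0 ≤ s := by rw [hs]; positivity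
  have hs1 : s ≤ 1 := min_le_right _ _
  have hspos : 0 < s := by rw [hs]; positivity
  have hmem : (⟨s, hs0, hs1⟩ : unitInterval) ∈ Metric.ball (0 : unitInterval) ε := by
    rw [Metric.mem_ball, Subtype.dist_eq, Real.dist_eq]
    show |s - 0| < ε
    rw [sub_zero, abs_of_pos hspos]
    exact lt_of_le_of_lt (min_le_left _ _) (by linarith)
  have h0 := hball hmem
  rw [mem_singleton_iff] at h0
  have : s = 0 := congrArg Subtype.val h0
  exact hspos.ne' this

/-- **Openness is not formal** (refutation of the natural strengthening): there is a family of
crossing functions with the UniformMarginality property, affine (hence uniformly analytic) in `t`,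
with the Smirnov base point `0 ∈ G` at modulus `e^{iπ/3}`, whose good set `G = {0}` is NOT open.
Hence `UM ∧ (0 ∈ G) ⇏ IsOpen G` in the abstract: the crux is a statement about `cornerCrossingProb`
specifically, and its proof must use structure of the corner model beyond S1/S2/S4/S5 of line
`Sketch` (all satisfied here) — i.e. `stub_noIsolatedGoodPoint`. -/
theorem not_isOpen_goodSet_of_marginal_family :
    ∃ P : unitInterval → ConformalRectangle → ℝ → ℝ,
      UMOf P ∧ (∀ R' δ, ∃ a b : ℝ, ∀ t : unitInterval, P t R' δ = a + b * (t : ℝ)) ∧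
      (0 : unitInterval) ∈ goodSetOf P ∧ goodSetOf P = {0} ∧ ¬ IsOpen (goodSetOf P) :=
  ⟨toyP, umOf_toyP, toyP_affine, zero_mem_goodSetOf_toyP, goodSetOf_toyP,
    by rw [goodSetOf_toyP]; exact not_isOpen_singleton_zero⟩

/-- The abstract strengthening of the crux, refuted: "for EVERY family, UM + base point ⇒ open". -/
theorem not_segmentOpen_abstract :
    ¬ ∀ P : unitInterval → ConformalRectangle → ℝ → ℝ,
        (0 : unitInterval) ∈ goodSetOf P → UMOf P → IsOpen (goodSetOf P) := by
  intro h
  have := h toyP zero_mem_goodSetOf_toyP umOf_toyP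
  rw [goodSetOf_toyP] at this
  exact not_isOpen_singleton_zero this

/-! ## §4 The modulus of a good point lies on the unit circle (`‖α‖ = 1`)

### §4.1 Conjugate moduli (any family) -/

/-- `φ_ᾱ = conj ∘ φ_α` pointwise. [cite: Beffara2008Universal, Proposition 4 (proof)] -/
theorem moduliShear_conj (α z : ℂ) : moduliShear (conj α) z = conj (moduliShear α z) := by
  apply Complex.ext <;> simp [moduliShear]

/-- `conj '' (φ_ᾱ '' S) = φ_α '' S`. [folklore] -/
theorem image_conj_image_moduliShear_conj (α : ℂ) (S : Set ℂ) :
    moduliShear (-I) '' (moduliShear (conj α) '' S) = moduliShear α '' S := by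
  rw [image_image]
  refine image_congr fun z _ => ?_
  rw [moduliShear_neg_I_apply, moduliShear_conj, Complex.conj_conj]

/-- **Conjugate moduli.** For ANY family `P`: Cardy limits after `φ_α` give Cardy limits after
`φ_ᾱ` (the conjugate rectangle `R*` of a presentation `R` of `φ_ᾱ R'` presents `φ_α R'`, and its
datum `(φ*, -x)` has the same cross-ratio). [cite: Beffara2008Universal, Proposition 4 (proof)] -/
theorem cardyModOf_conj {P : ConformalRectangle → ℝ → ℝ} {α : ℂ} (h : CardyModOf P α) :
    CardyModOf P (conj α) := by
  intro R R' φ x hc hp hu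
  obtain ⟨ψ, -, hψ⟩ := hu.exists_conjugate
  have hc' : R.conjugate.carrier = moduliShear α '' R'.carrier := by
    rw [conjugate_carrier_eq_image_moduliShear, hc, image_conj_image_moduliShear_conj]
  have hp' : ∀ i, R.conjugate.pt i = moduliShear α (R'.pt i) := fun i => by
    rw [conjugate_pt_eq_moduliShear, hp i, moduliShear_neg_I_apply, moduliShear_conj,
      Complex.conj_conj]
  have := h R.conjugate R' ψ (-x) hc' hp' hψ
  rwa [crossRatio_neg] at this

/-! ### §4.2 The diagonal reflection `τ w = i w̄` and inverse moduli -/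

/-- The diagonal reflection of the plane, `τ w = i · w̄` (`x + iy ↦ y + ix`), an involutive isometry;
`squareLatticeEmbedding` intertwines the transposition of `ℤ²` with it. [folklore] -/
def transposeHomeomorph : ℂ ≃ₜ ℂ where
  toFun w := I * conj w
  invFun w := I * conj w
  left_inv w := by simp [← mul_assoc]
  right_inv w := by simp [← mul_assoc]
  continuous_toFun := by fun_prop
  continuous_invFun := by fun_prop

/-- `τ w = i w̄`. [folklore] -/
@[simp] theorem transposeHomeomorph_apply (w : ℂ) : transposeHomeomorph w = I * conj w := rfl

/-- `τ` is an involution. [folklore] -/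
theorem transposeHomeomorph_involutive (w : ℂ) : transposeHomeomorph (transposeHomeomorph w) = w :=
  transposeHomeomorph.left_inv w

/-- `τ` is an isometry. [folklore] -/
theorem isometry_transposeHomeomorph : Isometry transposeHomeomorph :=
  Isometry.of_dist_eq fun x y => by
    simp only [transposeHomeomorph_apply, Complex.dist_eq]
    rw [← mul_sub, norm_mul, Complex.norm_I, one_mul, ← map_sub, Complex.norm_conj]

/-- `α · φ_{α⁻¹}(w) = φ_α (τ w)`: a shear by `α⁻¹` followed by the similarity `α·` is the shear by
`α` after the diagonal reflection. [folklore] -/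
theorem mul_moduliShear_inv (α : ℂ) (hα : α ≠ 0) (w : ℂ) :
    α * moduliShear α⁻¹ w = moduliShear α (transposeHomeomorph w) := by
  simp only [moduliShear, transposeHomeomorph_apply, mul_re, I_re, conj_re, zero_mul, I_im, conj_im,
    one_mul, zero_sub, neg_neg, mul_im, zero_add]
  field_simp
  ring

/-- **Inverse moduli under a diagonal symmetry.** If the family `P` is invariant under the
diagonal reflection of rectangles (`P (R'.map τ) = P R'` at every mesh), then Cardy limits after
`φ_α` give Cardy limits after `φ_{α⁻¹}`: a presentation `R` of `φ_{α⁻¹} R'` with datum `(φ, x)`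
yields the presentation `α · R` of `φ_α (τ R')` with datum `(α · φ, x)`
(`IsUniformizing.image_data`). [folklore] -/
theorem cardyModOf_inv_of_transpose {P : ConformalRectangle → ℝ → ℝ}
    (hP : ∀ (R' : ConformalRectangle) (δ : ℝ), P (R'.map transposeHomeomorph) δ = P R' δ)
    {α : ℂ} (hα : α ≠ 0) (h : CardyModOf P α) : CardyModOf P α⁻¹ := by
  intro R R' φ x hc hp hu
  -- the presentation `α · R` of `φ_α (τ R')`
  set R₂ := R.map (Homeomorph.mulLeft₀ α hα) with hR₂
  have hd : DifferentiableOn ℂ (fun z => α * z) R.carrier :=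
    (differentiable_id.const_mul α).differentiableOn
  have hi : InjOn (fun z => α * z) R.carrier := (mul_right_injective₀ hα).injOn
  have hcl : ContinuousOn (fun z => α * z) (closure R.carrier) :=
    (continuous_const.mul continuous_id).continuousOn
  have hS : R₂.carrier = (fun z => α * z) '' R.carrier := rfl
  have hpt : ∀ i, R₂.pt i = (fun z => α * z) (R.pt i) := fun _ => rfl
  have hu₂ := hu.image_data hd hi hcl hS hpt
  have hc₂ : R₂.carrier = moduliShear α '' (R'.map transposeHomeomorph).carrier := by
    rw [hS, hc, MarkedDomain.carrier_map, image_image, image_image]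
    exact image_congr fun w _ => mul_moduliShear_inv α hα w
  have hp₂ : ∀ i, R₂.pt i = moduliShear α ((R'.map transposeHomeomorph).pt i) := fun i => by
    rw [hpt i, hp i, MarkedDomain.pt_map]
    exact mul_moduliShear_inv α hα (R'.pt i)
  have hlim := h R₂ (R'.map transposeHomeomorph) _ x hc₂ hp₂ hu₂
  have hfun : P (R'.map transposeHomeomorph) = P R' := funext (hP R')
  rwa [hfun] at hlim

/-! ### §4.3 The corner model is invariant under the diagonal reflection -/

/-- `squareLatticeEmbedding` intertwines the transposition `(x₀, x₁) ↦ (x₁, x₀)` of `ℤ²` with `τ`.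
[folklore] -/
theorem squareLatticeEmbedding_z_transpose (x : Site 2) :
    squareLatticeEmbedding.z (transposeIso x) = transposeHomeomorph (squareLatticeEmbedding.z x) := by
  rw [squareLatticeEmbedding_z, squareLatticeEmbedding_z, Literature.Probability.Percolation.transposeIso_apply,
    transposeHomeomorph_apply]
  apply Complex.ext
  · simp [Literature.Probability.LatticeModels.Site.toComplex]
  · simp [Literature.Probability.LatticeModels.Site.toComplex]

/-- Rescaled version: `δ z (xᵀ) = τ (δ z x)` for real `δ`. [folklore] -/
theorem smul_z_transpose (δ : ℝ) (x : Site 2) :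
    (δ : ℂ) * squareLatticeEmbedding.z (transposeIso x) =
      transposeHomeomorph ((δ : ℂ) * squareLatticeEmbedding.z x) := by
  rw [squareLatticeEmbedding_z_transpose, transposeHomeomorph_apply, transposeHomeomorph_apply,
    map_mul, Complex.conj_ofReal]
  ring

/-- The vertices whose rescaled position lies in `τ Ω` are the transposed vertices for `Ω`.
[folklore] -/
theorem setOf_mem_transpose_image (Ω : Set ℂ) (δ : ℝ) :
    {y : Site 2 | (δ : ℂ) * squareLatticeEmbedding.z y ∈ transposeHomeomorph '' Ω} =
      (transposeIso : Site 2 → Site 2) '' {y : Site 2 | (δ : ℂ) * squareLatticeEmbedding.z y ∈ Ω} := by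
  rw [image_transposeIso]
  ext y
  simp only [mem_setOf_eq, mem_preimage]
  constructor
  · rintro ⟨w, hw, hwy⟩
    have : transposeHomeomorph ((δ : ℂ) * squareLatticeEmbedding.z y) = w := by
      rw [← hwy]; exact transposeHomeomorph_involutive w
    rw [smul_z_transpose, this]; exact hw
  · intro hy
    refine ⟨(δ : ℂ) * squareLatticeEmbedding.z (transposeIso y), hy, ?_⟩
    rw [smul_z_transpose]; exact transposeHomeomorph_involutive _

/-- The vertices within rescaled distance `2δ` of `τ A` are the transposed vertices for `A`.
[folklore] -/
theorem setOf_infDist_transpose_image (A : Set ℂ) (δ : ℝ) :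
    {u : Site 2 | Metric.infDist ((δ : ℂ) * squareLatticeEmbedding.z u) (transposeHomeomorph '' A) ≤ 2 * δ} =
      (transposeIso : Site 2 → Site 2) ''
        {u : Site 2 | Metric.infDist ((δ : ℂ) * squareLatticeEmbedding.z u) A ≤ 2 * δ} := by
  rw [image_transposeIso]
  ext u
  simp only [mem_setOf_eq, mem_preimage]
  have h : (δ : ℂ) * squareLatticeEmbedding.z u =
      transposeHomeomorph ((δ : ℂ) * squareLatticeEmbedding.z (transposeIso u)) := by
    rw [smul_z_transpose]; exact (transposeHomeomorph_involutive _).symm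
  rw [h, Metric.infDist_image isometry_transposeHomeomorph]

/-- The crude crossing event of `(τ Ω; τ A, τ B)` has the same `M_t`-probability as that of
`(Ω; A, B)` (diagonal-reflection invariance of `M_t`, `cornerPercolation_real_preimage_relabel_transpose`).
[cite: BollobasRiordan2010, §2 Cor. 2.3] -/
theorem corner_real_embDomainCrossing_transpose (t : unitInterval) (Ω A B : Set ℂ) (δ : ℝ) :
    (cornerPercolation t).real
        (embDomainCrossing squareLatticeEmbedding.z (transposeHomeomorph '' Ω) δ
          (transposeHomeomorph '' A) (transposeHomeomorph '' B)) =
      (cornerPercolation t).real (embDomainCrossing squareLatticeEmbedding.z Ω δ A B) := by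
  unfold embDomainCrossing
  rw [setOf_mem_transpose_image, setOf_infDist_transpose_image, setOf_infDist_transpose_image]
  rw [← cornerPercolation_real_preimage_relabel_transpose t (openCrossing _ _ _)]
  congr 1
  exact preimage_relabel_openCrossing transposeIso.toEquiv _ _ _

/-- **The corner model's crude crossing probabilities are `τ`-invariant** at every mesh.
[cite: BollobasRiordan2010, §2 Cor. 2.3] -/
theorem cornerCrossingProb_map_transpose (t : unitInterval) (R' : ConformalRectangle) (δ : ℝ) :
    cornerCrossingProb t (R'.map transposeHomeomorph) δ = cornerCrossingProb t R' δ := by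
  rw [cornerCrossingProb_eq, cornerCrossingProb_eq, MarkedDomain.carrier_map, MarkedDomain.arc_map,
    MarkedDomain.arc_map]
  exact corner_real_embDomainCrossing_transpose t R'.carrier (R'.arc 0) (R'.arc 2) δ

/-! ### §4.4 `‖α‖ = 1` -/

/-- **`‖α‖ = 1` for every good modulus of a `τ`-invariant family**: `ᾱ⁻¹ = α / ‖α‖²` is again a
good modulus of the upper half-plane (§1, §2), so it equals `α` (§4). [folklore] -/
theorem norm_eq_one_of_cardyMod_of_transpose {P : ConformalRectangle → ℝ → ℝ}
    (hP : ∀ (R' : ConformalRectangle) (δ : ℝ), P (R'.map transposeHomeomorph) δ = P R' δ)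
    {α : ℂ} (hα : 0 < α.im) (h : CardyModOf P α) : ‖α‖ = 1 := by
  have hα0 : α ≠ 0 := fun h0 => by rw [h0] at hα; simp at hα
  have h2 : CardyModOf P (conj α⁻¹) := cardyModOf_conj (cardyModOf_inv_of_transpose hP hα0 h)
  have hns : Complex.normSq α ≠ 0 := (map_ne_zero Complex.normSq).2 hα0
  have hnpos : 0 < Complex.normSq α := lt_of_le_of_ne (Complex.normSq_nonneg α) (Ne.symm hns)
  have him : (conj α⁻¹).im = α.im / Complex.normSq α := by
    rw [Complex.conj_im, Complex.inv_im, neg_div, neg_neg]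
  have hpos : 0 < (conj α⁻¹).im := by rw [him]; exact div_pos hα hnpos
  have heq : α = conj α⁻¹ := modulus_unique hα hpos h h2
  -- `conj α⁻¹ = α / normSq α`, so `normSq α = 1`
  have key : conj α⁻¹ * (Complex.normSq α : ℂ) = α := by
    rw [Complex.inv_def, map_mul, Complex.conj_conj, Complex.conj_ofReal, mul_assoc, ← Complex.ofReal_mul,
      inv_mul_cancel₀ hns, Complex.ofReal_one, mul_one]
  rw [← heq] at key
  have hone : (Complex.normSq α : ℂ) = 1 := mul_left_cancel₀ hα0 (key.trans (mul_one α).symm)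
  have hone' : Complex.normSq α = 1 := by exact_mod_cast hone
  rw [Complex.normSq_eq_norm_sq] at hone'
  have h3 : (‖α‖ - 1) * (‖α‖ + 1) = 0 := by nlinarith [hone']
  rcases mul_eq_zero.1 h3 with h4 | h4
  · linarith
  · linarith [norm_nonneg α]

/-- **The modulus of every good point of the crux lies on the unit circle**: if the crude corner-model
crossing probabilities at parameter `t` have Cardy limits after `φ_α` with `0 < im α` (i.e. `α`
witnesses `t ∈ G`), then `‖α‖ = 1` — equivalently `α = e^{iθ}`, `θ ∈ (0, π)`. [folklore] -/
theorem norm_eq_one_of_cardyMod (t : unitInterval) {α : ℂ} (hα : 0 < α.im)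
    (h : CardyModOf (cornerCrossingProb t) α) : ‖α‖ = 1 :=
  norm_eq_one_of_cardyMod_of_transpose (cornerCrossingProb_map_transpose t) hα h

/-- Bridge to the route decl: membership in the crux's good set is `∃ α, 0 < im α ∧ CardyModOf …`
(definitional), so every witness has `‖α‖ = 1`. [folklore] -/
theorem goodSet_moduli_norm_one (t : unitInterval)
    (ht : ∃ α : ℂ, 0 < α.im ∧ CardyModOf (cornerCrossingProb t) α) :
    ∃ α : ℂ, 0 < α.im ∧ ‖α‖ = 1 ∧ CardyModOf (cornerCrossingProb t) α := by
  obtain ⟨α, hα, h⟩ := ht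
  exact ⟨α, hα, norm_eq_one_of_cardyMod t hα h, h⟩


/-! ## §5 Marginality versus uniform analyticity (line `Sketch`, stub S4 `stub_uniformComplexBound`)

**What S4 says.**  For every `t₀` there is ONE radius `r > 0` such that for every conformal
rectangle `R` the crossing polynomials `p_{R,δ}` (`p_{R,δ}(t) = P_t(R,δ)` on `[0,1]`, S1, landed)
satisfy `sup_{δ>0} sup_{|z-t₀|<r} |p_{R,δ}(z)| < ∞`.  Large `δ` is harmless (finitely many
polynomials for `δ ≥ δ₁`); the content is `δ → 0`.

**(i) S4 is not a consequence of the crux hypothesis** (kernel-checked, file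
`Theorems/SegmentOpen/Negative/MarginalNotAnalytic.lean`:
`exists_marginal_family_not_uniformComplexBound`, `not_uniformComplexBound_of_marginal_abstract`):
the polynomial family `p_n = (4X(1-X))^{n+1}/(n+1)` is `[0,1]`-valued and uniformly `4`-Lipschitz
on `[0,1]` (UM shape with `η = ε/4`), yet `|p_n(1/2 + iy)| = (1+4y²)^{n+1}/(n+1) → ∞` for every
`y ≠ 0`.  (With the damping `e^{-2√n}` in place of `1/(n+1)` even ALL `t`-derivatives stay bounded
— marginality to all finite orders — while the blow-up persists; not formalised.)  So UA is an
unconditional claim about the corner model, to be proved from percolation structure or refuted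
numerically; the crux hypothesis UM is idle in line `Sketch` (UA ⊢ UM by Cauchy estimates).

**(ii) What UA means for `M_t` (Fourier reading).**  Fix `t₀ ∈ (0,1]`, `q = t₀/2`,
`σ² = q(1-q)`.  Averaging out the fair coins, `P_t(R,δ) = E_t[g(d)]` for a function `g` of the
`N_δ ≍ δ^{-2}` splitting bits in `R`, and the change of bias is EXACT:
`E_t[g] = Σ_S ((t-t₀)/(2σ))^{|S|} ĝ_{t₀}(S)` (`ĝ_{t₀}` = Fourier–Walsh coefficients at bias `q`),
i.e. the Taylor coefficients of `p_{R,δ}` at `t₀` are `(2σ)^{-k} W_k(δ)`,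
`W_k(δ) = Σ_{|S|=k} ĝ_{t₀}(S)` the SIGNED level-`k` sums.  UA at `t₀` with radius `r` is
EQUIVALENT to `|W_k(δ)| ≤ C_R (2σ/r)^k` for all `k` and `δ`.  Level `k = 1` is the Russo sum
(first-order marginality, the route's crux 5472 is its continuity form); the UNSIGNED level-`k`
mass of a crossing event is `≍ (δ^{-3/4})^k` (4-arm counting), so UA demands cancellation to
relative precision `δ^{3k/4}` at every fixed level, and geometric control beyond.  No structural
reason for such cancellations beyond `k = 1` (where `λ⁺ = λ⁻` is forced by `P_t(square) ≡ ½`) is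
known; none is refuted either.

**(iii) The negative real axis = parity correlations.**  At `t₀ = 0` and `t = -s < 0` the corner
weights are `(½ + s/4)` (tied) and `(-s/4)` (split): a signed measure of total variation `(1+s)^{N}`
(`N = #` full corners), and `p_{R,δ}(-s) = (1+s)^{N} · E_{q̃}[(-1)^{#split corners} · 1_cross]`
with `q̃ = s/(2+2s)`.  Hence UA at `0` with radius `> s` forces the parity/crossing correlation at
splitting density `q̃` to be EXPONENTIALLY small, `≤ C (1+s)^{-N} = C e^{-Θ(s δ^{-2})}`.  For the
self-dual box `[0,n+1]×[0,n]` it vanishes identically (the `π`-rotation + duality pairs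
configurations with opposite parity sign and complementary crossing indicator, which is why
`P ≡ ½` as a polynomial); for other shapes nothing is known.  Similarly at `t₀ = 1` (bond-`ℤ²`):
`(-1)^{#split} = (-1)^{#open edges}`, and the top Taylor coefficient of `p_{R,δ}` at any centre is
`4^{-N} Σ_j (-1)^j A_j = E_{P_{1/2}}[(-1)^{#open edges} 1_cross]` — the correlation of the LR
crossing of bond-`ℤ²` with the global edge parity.  UA with radius `r > 1` somewhere would make it
`O((4/r)^N) ≪ 4^{-N}·#configurations`-small; the cycle-1 ideator data (radius `≈ 1.3` at `t₀ = 1`,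
`1.7–2.3` at `0, ½`, `H ≤ 9`) sit exactly in this regime, so the probe below also measures whether
these parity correlations really decay exponentially in the AREA.

**(iv) Status.**  S4 is neither provable from the crux nor refuted; its cheapest falsifier is the
growth in `H` of the circle maxima `M(c,ρ;H)` (jobs of `-- Numerics`).  A collapse `ρ*(H) → 0` of
the tame radius kills line `Sketch`'s spine B (fallback: card A inside the same line, see
`PICKED.md`); it would NOT refute the crux. -/

/-- Bridge: the work-file template `CardyModOf` is the landed `CardyMod'` (same body). [folklore] -/
theorem cardyModOf_iff_cardyMod' (P : ConformalRectangle → ℝ → ℝ) (α : ℂ) :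
    CardyModOf P α ↔ Summit.CriticalPhenomena.CardyFormulaZ2.Theorems.SegmentOpen.Negative.CardyMod' P α :=
  Iff.rfl

/-- The UniformMarginality SHAPE (equicontinuity on `[0,1]`, uniform in the index) and
`[0,1]`-valuedness do NOT imply the `stub_uniformComplexBound` SHAPE (uniform complex bound on a
disc around `t₀ = 1/2`): landed as `Negative.not_uniformComplexBound_of_marginal_abstract`, witness
`p_n = (4X(1-X))^{n+1}/(n+1)` (`Negative.exists_marginal_family_not_uniformComplexBound`).
Restated here for the record of §5(i). [folklore] -/
theorem um_shape_not_implies_ua_shape :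
    ¬ ∀ p : ℕ → Polynomial ℝ,
        (∀ (n : ℕ) (t : ℝ), t ∈ Icc (0 : ℝ) 1 → (p n).eval t ∈ Icc (0 : ℝ) 1) →
        (∀ ε > 0, ∃ η > 0, ∀ (n : ℕ) (s t : ℝ), s ∈ Icc (0 : ℝ) 1 → t ∈ Icc (0 : ℝ) 1 →
          |t - s| < η → |(p n).eval t - (p n).eval s| < ε) →
        ∃ r > 0, ∃ K : ℝ, ∀ (n : ℕ), ∀ z ∈ Metric.ball (((1 / 2 : ℝ)) : ℂ) r,
          ‖((p n).map (algebraMap ℝ ℂ)).eval z‖ ≤ K :=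
  Summit.CriticalPhenomena.CardyFormulaZ2.Theorems.SegmentOpen.Negative.not_uniformComplexBound_of_marginal_abstract

/-! ## §6 Endpoint pinning: the modulus of `G` is `ζ` at `0` and `i` at `1` — frozen-modulus
strengthenings of the crux are false (landed: `Theorems/SegmentOpen/Negative/FrozenModulus.lean`)

`G = ⋃_{im α > 0} G_α`, `G_α = {t | CardyMod t α}`, a DISJOINT union (§2).  The proved cone items
`SmirnovBasePoint` (5474) and `QuarterTurnPinning` (5475) pin `G_ζ ∋ 0`, `G_i ∋ 1`, and by
uniqueness `α(0) = ζ`, `α(1) = i`.  Consequences recorded here over the work-file API. -/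

section Pinning
open Summit.CriticalPhenomena.CardyFormulaZ2.Theorems.SegmentOpen.Negative
  (modulus_zero_eq_triZeta modulus_one_eq_I zero_mem_goodSetAt_triZeta not_exists_frozen_modulus
   not_forall_isOpen_goodSetAt_of_target cardyMod'_of_im_eq_zero triZeta_ne_I)

/-- `α(0) = ζ`: the only upper-half-plane modulus witnessing `0 ∈ G`. [cite: Smirnov2001, Thm. 1] -/
theorem goodSet_modulus_zero {α : ℂ} (hα : 0 < α.im) (h : CardyModOf (cornerCrossingProb 0) α) :
    α = triZeta :=
  modulus_zero_eq_triZeta hα h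

/-- `α(1) = i`: the only upper-half-plane modulus witnessing `1 ∈ G`. [cite: Beffara2008Universal, §2.2] -/
theorem goodSet_modulus_one {α : ℂ} (hα : 0 < α.im) (h : CardyModOf (cornerCrossingProb 1) α) :
    α = I :=
  modulus_one_eq_I hα h

/-- `0 ∈ G` unconditionally (Smirnov base point, proved in tree). [cite: Smirnov2001, Thm. 1] -/
theorem zero_mem_goodSet : (0 : unitInterval) ∈ goodSetOf cornerCrossingProb :=
  ⟨triZeta, triZeta_im_pos', zero_mem_goodSetAt_triZeta⟩

/-- So `G ≠ ∅`: of the three trivialising scenarios of §1 only `G = univ` (Target) and `¬UM` remain. -/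
theorem goodSet_nonempty : (goodSetOf cornerCrossingProb).Nonempty := ⟨0, zero_mem_goodSet⟩

/-- **The frozen strengthening of the Target** (`∃α ∀t` instead of `∀t ∃α`). -/
def FrozenTarget : Prop :=
  ∃ α : ℂ, 0 < α.im ∧ ∀ t : unitInterval, CardyModOf (cornerCrossingProb t) α

/-- **`FrozenTarget` is false**: no single linear map makes every `M_t` Cardy (`α(0) = ζ ≠ i = α(1)`).
[folklore] -/
theorem not_frozenTarget : ¬ FrozenTarget :=
  not_exists_frozen_modulus

/-- **The modulus-by-modulus strengthening of the crux's conclusion**: every fixed-modulus good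
set `G_α` is open. -/
def SegmentOpenFrozen : Prop :=
  ∀ α : ℂ, 0 < α.im → IsOpen {t : unitInterval | CardyModOf (cornerCrossingProb t) α}

/-- **`SegmentOpenFrozen` is incompatible with the Target**: the `G_α` are disjoint, `G_ζ ∋ 0`,
`G_ζ ∌ 1`; all open would disconnect `[0,1]`.  So no proof of `SegmentOpen` useful to the route can
keep the shear fixed near a good point. [folklore] -/
theorem not_segmentOpenFrozen_of_target (hT : Target) : ¬ SegmentOpenFrozen :=
  not_forall_isOpen_goodSetAt_of_target hT

/-- The same with the Target replaced by `G = univ` (its set form). [folklore] -/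
theorem not_segmentOpenFrozen_of_goodSet_eq_univ (h : goodSetOf cornerCrossingProb = univ) :
    ¬ SegmentOpenFrozen :=
  not_segmentOpenFrozen_of_target fun t => (h ▸ mem_univ t : t ∈ goodSetOf cornerCrossingProb)

/-- `G` is the union of the fixed-modulus good sets. [folklore] -/
theorem goodSetOf_eq_iUnion :
    goodSetOf cornerCrossingProb =
      ⋃ α ∈ {α : ℂ | 0 < α.im}, {t : unitInterval | CardyModOf (cornerCrossingProb t) α} := by
  ext t
  simp only [goodSetOf, mem_setOf_eq, mem_iUnion, exists_prop]

/-- ... and the union is disjoint (modulus uniqueness, §2). [folklore] -/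
theorem goodSetAt_disjoint {α β : ℂ} (hα : 0 < α.im) (hβ : 0 < β.im) (hne : α ≠ β) :
    Disjoint {t : unitInterval | CardyModOf (cornerCrossingProb t) α}
      {t : unitInterval | CardyModOf (cornerCrossingProb t) β} :=
  Set.disjoint_left.2 fun _ ha hb => hne (modulus_unique hα hβ ha hb)

/-- At least two of the `G_α` would be nonempty under the Target: `G_ζ ∋ 0` always, and `1 ∉ G_ζ`.
[folklore] -/
theorem one_not_mem_goodSetAt_triZeta' :
    (1 : unitInterval) ∉ {t : unitInterval | CardyModOf (cornerCrossingProb t) triZeta} := fun h =>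
  triZeta_ne_I (goodSet_modulus_one triZeta_im_pos' h)

/-- **The side condition `0 < im α` is load-bearing (vacuity for real `α`)**: for `im α = 0` the
template holds for EVERY family. [folklore] -/
theorem cardyModOf_real (P : ConformalRectangle → ℝ → ℝ) {α : ℂ} (h : α.im = 0) : CardyModOf P α :=
  cardyMod'_of_im_eq_zero P h

/-- The crux with the side condition `0 < im α` DROPPED from its good set. -/
def SegmentOpenWithoutImPos : Prop :=
  UMOf cornerCrossingProb → IsOpen {t : unitInterval | ∃ α : ℂ, CardyModOf (cornerCrossingProb t) α}

/-- ... is TRIVIALLY TRUE (the good set is `univ` via `α = 0`): hypothesis mutation (a) — the side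
condition is what makes the crux non-trivial. [folklore] -/
theorem segmentOpenWithoutImPos_trivial : SegmentOpenWithoutImPos := fun _ => by
  have h : {t : unitInterval | ∃ α : ℂ, CardyModOf (cornerCrossingProb t) α} = univ :=
    eq_univ_of_forall fun t => ⟨0, cardyModOf_real _ (by simp)⟩
  rw [h]
  exact isOpen_univ

end Pinning

/-! ## -- Targets (line `Sketch`, lead prover-line-stmt-CriticalPhenomena-5471-0)

Active stubs (skeleton 5b4f1ec03aba), status at cycle 2:
* S1 `stub_crossingProbPolynomial` — LANDED (p97364).
* S2 `stub_vitaliTransfer` — LANDED (p98357) in the weak `∃ r`-after-`R` form flagged in cycle 1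
  (evidence `VitaliTransfer.md`); S5 must redo Vitali on the uniform UA disc.
* S3 `stub_localUniformRSW` — LANDED (p101486).
* S4 `stub_uniformComplexBound` (UA) — OPEN, research.  §5: NOT derivable from UM (abstract
  counter-family, `Negative/MarginalNotAnalytic.lean`); equivalent to geometric control of the signed
  level-`k` Fourier sums of the crossing function; on the negative axis = exponential smallness of
  parity/crossing correlations.  Falsifier running (`-- Numerics`, jobs j019124/j019126).  Not
  refutable by small models (a statement about `δ → 0`); not refuted.
* S5 `stub_accumulationInterior` — OPEN (classical conformal geometry + chart).  §6 adds two exact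
  constraints any modulus chart must meet: `α(t) → ζ` as good `t → 0` and `α(t) → i` as good
  `t → 1` along `G` (pinning + the continuity S5 itself provides); `‖α(t)‖ = 1` throughout (§4).
* S6 `stub_noIsolatedGoodPoint` — OPEN (= the crux modulo S4/S5; cycle 1 §3).  §6: it cannot be
  obtained with a frozen modulus either (`not_segmentOpenFrozen_of_target`).
No stub is refuted.  Joint sufficiency is kernel-checked by the lead (`segmentOpen_of_stubs`).

## -- Numerics

* cycle 1 (identity refuter-cdisprove-stmt-CriticalPhenomena-5471-0): kit j017228 (exact TM,
  complex-`t` zeros, rows ≤ 12; finished ok 17:00Z, 11757 s) and j017227 (Russo-sum MC of `∂_t P_t`,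
  diamond + boxes; still running 17:12Z).  Their artefacts are attached to the crux item as operator
  evidence `compute-j017228.json` / (pending) but are NOT readable from the cycle-2 seat (evidence
  store not mounted; `kit compute fetch` is owner-locked) — whoever can read them: the TM table there
  supersedes rows `H ≤ 12` below if it disagrees.
* cycle 2: ONE exact transfer-matrix probe of S4, code `job_ua/` of this seat (state = non-crossing
  partition of the column frontier + virtual left vertex; `H = 8`: 11934 states; validated against
  brute-force enumeration on boxes ≤ 2×3 at rational `t` (exact agreement) and the self-dual sentinel
  `P_{H,H+1} ≡ ½` at complex `t`; numpy path self-checks against the pure-python TM in-job):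
  - kit **j019124** (`H = 3…12`; shapes square `W = H`, sentinel `W = H+1`, 2:1 `W = 2H`; 213
    complex points: circles `|t-c| = ρ`, `c ∈ {0,½,1}`, `ρ ∈ {½,¾,1,1¼,1½,2}`, 9 angles; negative
    axis `t = -0.1…-3.0`; `t = 1.1…3.0`; `c + iy`, `y = ¼…3`; `[0,1]`; Taylor `c_0…c_7` at each
    centre by 16-point contour FFT on `ρ = ½`);
  - kit **j019126** (`H = 13`, ≈ 6·10⁶ states, 51 points).
  READING: UA at `c` with radius `r` ⇔ `M(c,ρ;H) = max_{|t-c|=ρ} |P_{H,W}(t)|` bounded in `H` for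
  every `ρ < r`; KILL of S4 = a tame radius `ρ*(H)` decreasing to `0` (polynomially); SUPPORT =
  `M(c,ρ;H)` converging in `H` for `ρ` up to `≈ 1`.  Cycle-1 ideator values to reproduce
  (`H ≤ 9`): squares `max_{t∈[0,1]}|P(t+2i)| = 0.641, 0.610, …, 0.546`; 2:1 at `t = -1`:
  `0.185, 0.175, 0.167` (`H = 7,8,9`); blow-up thresholds `|Im t| ≈ 2.9 (H4) → 2.1 (H9)`,
  `t ≈ -2 (H6) → -1.4 (H9)`.
  RESULTS (2026-08-16; local pure-python run `H ≤ 9`; kit j019207 `H = 3…10`, 213 points, double;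
  kit j019209 `H = 4, 8…11`, 51 points, 80-bit — the two precisions agree to `≤ 3·10⁻¹²` relative
  on all non-sentinel points through `H = 10`; kit j019208 (`H = 13`) died of memory in the table
  stage and j019207/j019209 hit their 30-min limit, so `H = 12, 13` are re-queued as j019453/j019454
  with a faster kernel; numbers below are final for `H ≤ 11`):
  * TAME PLATEAU.  On `|t - c| ≤ 1.25` around `c ∈ {0, ½, 1}` every value is size-stable to the
    third digit and drifts monotonically like the real crossing probabilities themselves, e.g.
    squares `|P_{H,H}(2i)| = 0.610 0.590 0.576 0.565 0.558 0.551 0.546 0.541 0.536` (`H = 3…11`),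
    `P_{H,H}(-1.25) = 0.653 0.627 0.610 0.597 0.587 0.579 0.572 0.566 0.561`; 2:1 boxes
    `P_{H,2H}(-1.25) = 0.274 0.229 0.200 0.180 0.165 0.154 0.145 0.139 0.133`,
    `|P_{H,2H}(1+2i)| = … 0.301 0.295 0.291 0.287 0.283`.  Circle maxima `M(c,ρ;H)` for `ρ ≤ 1.25`
    (all centres, both shapes) decrease monotonically in `H` (e.g. 2:1, `c = ½`, `ρ = 1`:
    `0.298 0.280 0.267 0.258 0.251 0.245 0.240 0.235`, `H = 4…11`).
  * EXPONENTIAL BLOW-UP REGION.  Outside a fixed neighbourhood the values explode with a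
    SIZE-STABLE RATE PER CORNER `ψ(t) = Δlog|P|/ΔN` (`N = WH`), e.g. 2:1 box, `H = 8→9 | 9→10 |
    10→11`: `ψ(-1.5) = 0.129 | 0.152 | 0.149`, `ψ(-2) = 0.338 | 0.346`, `ψ(-2.5) = 0.504 | 0.509`,
    `ψ(-3) = 0.644 | 0.650`; `ψ(2.5i) = 0.281 | 0.291`, `ψ(3i) = 0.453 | 0.459`; `ψ(½+2.5i) = 0.241 |
    0.250`; `ψ(1+2.5i) = 0.254 | 0.251`; `ψ(2.5) = 0.105 | 0.101`, `ψ(3) = 0.275 | 0.276`.  `ψ` is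
    LINEAR in the distance (slope `≈ 0.40` per unit of `t` near onset, `0.3` far out), as for a
    second "phase" `P_N ≈ A(t) + B(t)e^{N g(t)}` whose boundary `{Re g = 0}` is where `ψ → 0⁺`:
    linear zeros at `t ≈ -1.12` (negative axis; squares, less converged, `-1.4`), `≈ 1.72 i`,
    `≈ ½ + 1.93 i`, `≈ 1 + 1.91 i` (2:1; squares `1.86 i, ½ + 1.97 i, 1 + 1.91 i`), right real
    boundary `≈ 2.3` (beyond the web point `t = 2`, where `P_{H,2H}(2) = 0.119 … 0.061 → 0`).
    CHECKED PREDICTION: the picture formed at `H ≤ 9` implies that the 2:1 plateau at `2i`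
    (`ψ(2i) ≈ 0.4·(2 - 1.72) = 0.11`) must break near `H ≈ 10–11` while `1 + 2i` (`ψ ≈ 0.04`)
    stays regular: observed `|P_{H,2H}(2i)| = 0.276 0.267 0.260 0.249 0.229 → 19.4` (`H = 6…11`,
    measured `ψ = 0.106`) and `|P_{H,2H}(1+2i)| = 0.283` regular at `H = 11`.  The apparent
    thresholds `s₁(H) = 2.9 2.2 2.0 1.8 1.6 1.5 1.5 1.4 (1.25,1.5]` (`H = 3…11`) obey the
    visibility rule `ψ(s₁)·N ≈ 18–20`, i.e. `s₁ → s* ≈ 1.1`, NOT `→ 0`.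
  * READING FOR S4.  No exponential blow-up within distance `≈ 1.1` of `0`, `≈ 1.3` of `1`,
    `≈ 1.6` of `½`: UA is numerically SUPPORTED with radius `r ≈ 1` (uniformly along `[0,1]`), the
    nearest singular set being a Lee–Yang-type phase boundary of the complex corner measure
    restricted to crossing configurations.  What the probe CANNOT decide: polynomial or
    logarithmic growth inside the plateau.  The low-order Taylor coefficients drift slowly —
    squares, `c = 0`: `c₁ = -0.0084 -0.0079 -0.0075 -0.0070 -0.0066`, `c₂ = 0.0043 0.0039 0.0035
    0.0032 0.0030` (`H = 6…10`), per-step decrements shrinking by only `×0.85` — and over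
    `H = 6…10` `a + b log H` fits `c₁, c₂, c₄` better than `a + b/H` (rss `5·10⁻⁹` vs `3·10⁻⁸` for
    `c₁`), but the real crossing probabilities drift just as slowly (`P_{H,H}(0) - ½ ∝ H^{-0.7}`
    over this range), so a `log δ⁻¹` divergence of `c₂` (which WOULD falsify UA by Cauchy's
    estimate, with no exponential signature) can be neither excluded nor supported at `N ≤ 338`.
  * `H = 12` (kit j019453, 51 points, CSR kernel; 2026-08-16T19:20Z).  The sharpest test proposed
    above — the 2:1 value at `t = -1.25`, regular trend `0.154 0.145 0.139 0.133 (→ ≈ 0.128)` — shows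
    the ONSET exactly where `s* ≈ 1.1` puts it: `P_{12,24}(-1.25) = 0.0728`, a deviation of `-0.055`,
    i.e. `ψ(1.25) ≈ (19 + log 0.055)/288 ≈ 0.056`; with `ψ(1.5) = 0.15` the slope is `0.38` per unit
    and the linear zero is `s* = 1.25 - 0.056/0.38 = 1.10`.  Meanwhile `P_{12,24}(-1) = 0.151`
    (trend `0.175 0.167 0.160 0.155 0.151`, regular), the whole disc `|t - ½| ≤ 1.5` is tame
    (`max = 0.273 0.269 0.266 0.263`, `H = 9…12`, decreasing), `|P_{12,24}(1+2i)| = 0.281` regular,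
    `|P_{H,2H}(2i)| = 19.4 → 1.5·10³` (`ψ = 0.095`, `y* ≈ 1.75`); squares: `P_{12,12}(-1.5) = 63.6`
    (`ψ = 0.10`), square boundary estimate `1.41 → 1.29` (slower finite-size convergence of `ψ`).
    PREDICTION for `H = 13` (`N = 338`): `|P_{13,26}(-1.25)| ≈ 0.055·e^{0.056·50} ≈ 0.9` (order one,
    sign may flip), `P_{13,26}(-1) ≈ 0.147` regular.
  * `H = 13` squares (kit j019469, 23 points, `N = 169`; 2026-08-16T19:37Z): `P_{13,13}(-1.25) = 0.554`
    (trend `0.566 0.561 0.557 → 0.554`, regular), `P_{13,13}(-1.5) = 5.3·10³` (blown, `63.6` at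
    `H = 12`), `|P_{13,13}(1+2i)| = 0.527` (trend `0.535 0.532 0.529 → 0.527`, regular) but
    `|P_{13,13}(2i)| = 0.572` against the trend `0.541 0.536 0.533`: the SQUARE plateau starts to
    break at `2i` exactly at `H = 13`, the second prediction made at `H ≤ 9` (`y*(0) ≈ 1.75–1.86 <
    2 < y*(1) ≈ 1.9`'s visibility at this `N`).  Double precision starts to bite only on blown-up
    points (`2` amplitude flags at `W = 14`).  The 2:1 box at `H = 13` (the `t = -1.25` test,
    predicted `≈ 0.9`) is job j019650 (queued at the time of writing; its stdout tail is attached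
    to the crux item as operator evidence `compute-j019650.json` when it ends).
  * BOTTOM LINE (S4): across `H = 3…13`, `N ≤ 338`, the corner-model crossing polynomials are
    uniformly tame on `{dist(t,[0,1]) ≲ 1}` and blow up exponentially in the AREA outside a
    boundary at finite distance (`≈ -1.1`, `≈ ±1.75–1.95 i`, `≈ 2.3`) with a size-stable, linearly
    vanishing rate; two quantitative predictions of this picture were confirmed at larger sizes.
    `stub_uniformComplexBound` is SUPPORTED numerically with `r ≈ 1`; it is not refuted, and by
    `MarginalNotAnalytic`/`AllOrdersNotAnalytic` it is not provable from UM or from jets either —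
    it is the genuine non-perturbative content of line `Sketch`'s spine.
-/

end Summit.CriticalPhenomena.CardyFormulaZ2.Cruxes.SegmentOpen.Disproof

end
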